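/-
Copyright (c) 2026 the pub-hodgecm-mathlib formalisation cell (harness21).  Prover seat hodgecm-mathlib-A-p17 (g26), P6 «MOD programme»,
organ (ν5) of the G1c «ROOF REDUCTION» remainder, part 2 (the package); 2026-09-01.
-/
import Literature.AlgebraicGeometry.AbelianSchemes.AbelianSchemeStageFibreBookkeeping
import Literature.AlgebraicGeometry.AbelianSchemes.AbelianSchemeMorphismSpreadFiniteStage
import Literature.AlgebraicGeometry.Limits.IsMonHomOfPullbackSchematicDominant
import Literature.AlgebraicGeometry.AbelianSchemes.IsogenyOfGenericIsogeny
import Literature.AlgebraicGeometry.AbelianSchemes.AbelianSchemeFibreFrobeniusTwistHom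
import Literature.AlgebraicGeometry.Motives.AbelianVarietyKernelDimension
import Mathlib.RingTheory.DedekindDomain.IntegralClosure
import HarnessLib

/-!
# DESCEND-AND-EXTEND OVER A FINITE DEDEKIND STAGE: an `Ω̄`-homomorphism between the geometric generic fibres of two abelian
# schemes over a Dedekind `D` extends — over a finite refinement `D′ ⊇ D` — to a homomorphism of abelian schemes
# ([EGAIV3] 8.8.2 (i); [BoschLutkebohmertRaynaud1990] §1.2 Prop. 8, §7.3 Prop. 6; [Artin1986NeronModels] (1.1), Cor. (1.4))

Topic `AlgebraicGeometry/AbelianSchemes`, namespace `Literature.AlgebraicGeometry.AbelianSchemes.AbelianSchemeOver`.  THEOREMS ONLY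
(no definition, no named fact, no instance, no notation, no `sorry`).  Cell `hodgecm-mathlib` (D-0151), F0∕P6 «MOD», organ **(ν5)** of the
G1c «ROOF REDUCTION» remainder — the ONE-CALL PACKAGE for the σ-pens of `stub_HFROB` promised in A-p17 (g26)'s FINDING «G1c BASE IS NOT
DEDEKIND» (2026-09-01): it composes ★ (ν2a) `AbelianScheme.exists_field_stage_hom_baseChange_eq_of_algHom` (A-p14; EGA IV₃ 8.8.2 spread to a
FINITE FIELD stage), ★ (ν2b) `Limits.isMonHom_of_isMonHom_pullback_map` (A-p14; base change along a quasi-compact schematically dominant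
morphism reflects homomorphisms), the ★ Néron mapping property over a Dedekind base (`existsUnique_hom_map_genericFibre_eq′`,
[BoschLutkebohmertRaynaud1990] Prop. 1.2∕8) and ★ `isIsogeny_fibreHom_of_isIsogeny_genericFibre` (§7.3 Prop. 6), and does ALL the
transitivity-isomorphism bookkeeping (★ `Limits.pullbackFacObjIso` ↔ ★ `fibreBaseChangeIso`) once.

## The statement (`exists_finiteStage_hom_extension`)

`D` Dedekind with fraction field `L` (`L` perfect, e.g. characteristic `0`), `Ω ⊇ L` an ALGEBRAIC field extension, `R ⊆ Ω` a valuation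
subring with `h : D → R` over `L → Ω` (the case of record: `R = 𝒪_{Ω̄}` = ★ `closureValuationSubring`, `D = integralClosure 𝒪[F] L` a finite stage of
★ (ν1)), `a : Spec Ω → Spec D` the geometric generic point (`Spec Ω → Spec L → Spec D`), `A, C` abelian schemes over `Spec D` and
**`u : A_a → C_a` a HOMOMORPHISM of the geometric generic fibres** (a morphism of abelian varieties over `Ω`).  THEN there are: a finite field
extension `L′ ⊇ L` inside `Ω` (`χ : L′ →ₐ[L] Ω` injective, `Module.Finite L L′`), the refined stage `D′ := integralClosure D L′` (DEDEKIND, fraction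
field `L′`) with `h′ : D′ → R` extending `h` (`h′ x = χ x` in `Ω`), and **a HOMOMORPHISM `U : A_{D′} → C_{D′}` of abelian schemes over `Spec D′`
whose fibre at the geometric generic point `a′ = Spec Ω → Spec R → Spec D′` (with `a′ ≫ Spec(D → D′) = a`) IS `u`** — read through the
transitivity isomorphisms ★ `fibreBaseChangeIso` ≪≫ ★ `fibreCongrPtIso`: `U_{a′} ≫ e_C = e_A ≫ u` — which is the UNIQUE `D′`-morphism with
that `Ω`-fibre, and **whose fibre at EVERY field-valued point of `Spec D′` is an isogeny as soon as `u` is**.  With ★ (ν4)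
`exists_iso_fibre_generic∕special_along_stagePoint` (the tuples at `y`, `red_𝓨 y` = fibres of `univ_z` over the stage) this turns an `Ω`-roof∕
`Ω`-isogeny between the tuples at two generic points into a homomorphism∕isogeny between the tuples at their reductions — over a DEDEKIND base,
never touching an abelian scheme over the non-noetherian `𝒪_{Ω̄}`.

## Proof

PART 1 (★ `AbelianSchemeStageFibreBookkeeping`): the refined stage lands in `R`; FIVE transitivity isomorphisms compose to ★ `fibreBaseChangeIso`
(`facChain_eq_fibreBaseChangeIso`), whence the `Ω`-fibre of any `U` whose `L′`-generic fibre is the transported spread is the transported `u`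
(`pullback_map_eq_of_facChain`); `Spec` of an injective ring map is dominant.  HERE the assembly: spread `u`
to `F` over a finite field stage `L′` (★ ν2a, `k = T = L`, `K = Ω`), transport to the generic fibres over `D′`, extend over `D′` by Néron, identify
the `Ω`-fibre (§2), conclude `IsMonHom U` by ★ (ν2b) along the schematically dominant `Spec Ω → Spec D′`, uniqueness by ★
`pullback_map_injective_of_flat`, and the isogeny clause: the generic fibre `U_{L′}` is surjective (its base change to `Ω` is `u` up to
isomorphisms; surjectivity descends along the surjective `Spec Ω → Spec L′`) of the right dimension (relative dimension is constant over the connected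
`Spec D′`, ★ `exists_isOfRelDim` ∕ `dim_fibre_of_isOfRelDim`; `dim A_a = dim C_a` by ★ `dim_eq_of_isIsogeny`), hence an isogeny (★
`isIsogeny_of_surjective_of_dim_eq`), hence so is every fibre (★ `isIsogeny_fibreHom_of_isIsogeny_genericFibre`).

HONEST LABEL: HC_CM is proved only modulo the cell's 2 remaining named inputs (hLiu418 24832, h413 24833) until rung 0 closes; generic capital on
`--supports stmt-HodgeConjecture-24832`, pays no letter.

## References
* [EGAIV3] A. Grothendieck, J. Dieudonné, EGA IV₃ (Publ. Math. IHÉS 28, 1966), Thm. 8.8.2 (i), 11.10.5.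
* [BoschLutkebohmertRaynaud1990] S. Bosch, W. Lütkebohmert, M. Raynaud, *Néron Models* (1990), §1.2 Prop. 8, §7.3 Prop. 6.
* [Artin1986NeronModels] M. Artin, *Néron models*, in: Arithmetic Geometry (Cornell–Silverman, 1986), §1 (1.1), Cor. (1.4).
* [GortzWedhorn2020] U. Görtz, T. Wedhorn, *Algebraic Geometry I*, 2nd ed. (2020), Section (4.7), Prop. 4.16, Prop. 9.19, Thm. 10.57.
* [GortzWedhorn2023] U. Görtz, T. Wedhorn, *Algebraic Geometry II* (2023), Prop. 27.176, Cor. 27.177.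
* [NeukirchANT1999] J. Neukirch, *Algebraic Number Theory* (1999), Ch. II (4.8), Ch. I (8.1).
* [StacksProject] The Stacks Project, Tags 01ZC, 030C, 0ASP.
-/

set_option autoImplicit false

noncomputable section

-- `(Over.pullback s).obj _`, `(A.baseChange s).X`, `(A.fibre s).toAbelianVariety.X` agree only above `instances` transparency (as in ★ (d1)–(d5)).
set_option backward.isDefEq.respectTransparency false

universe u

open CategoryTheory CategoryTheory.Limits AlgebraicGeometry Polynomial
open scoped MonObj CategoryTheory.Obj
open Literature.NumberTheory.EllipticCurves (genericFibre specGenericPoint)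
open Literature.AlgebraicGeometry.Motives (AbelianVariety SchemeOver)
open Literature.AlgebraicGeometry.Limits (pullbackFacObjIso pullbackFacObjIso_naturality pullbackFacObjIso_hom_left_fst
  pullbackFacObjIso_hom_left_fst_assoc pullbackFacObjIso_hom_left_snd)

namespace Literature.AlgebraicGeometry.AbelianSchemes

namespace AbelianSchemeOver

variable {D : Type u} [CommRing D] [IsDedekindDomain D] {L : Type u} [Field L] [Algebra D L]
  [IsFractionRing D L] [PerfectField L] {Ω : Type u} [Field Ω] [Algebra L Ω] [Algebra.IsAlgebraic L Ω]

/-- **DESCEND-AND-EXTEND OVER A FINITE DEDEKIND STAGE.**  `D` Dedekind with perfect fraction field `L`, `Ω ⊇ L` algebraic, `R ⊆ Ω` a valuation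
subring, `h : D → R` over `L → Ω` (`hh`), `a : Spec Ω → Spec D` with `Spec(L → Ω) ≫ η_L = a` (`ha`), `A, C` abelian schemes over `Spec D`,
`u : A_a → C_a` a homomorphism of abelian varieties over `Ω`.  THEN there exist a finite field stage `L′` (`Field`, `Algebra L L′`, `Algebra D L′`,
`IsScalarTower D L L′`, `Module.Finite L L′`, `χ : L′ →ₐ[L] Ω` injective), `h′ : D′ := integralClosure D L′ → R` (`h′ x = χ x` in `Ω`,
`h′ ∘ (D → D′) = h`; `D′` Dedekind with fraction field `L′`), and a HOMOMORPHISM `U : A_{D′} → C_{D′}` over `Spec D′` together with the point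
equality `e : a′ ≫ Spec(D → D′) = a`, `a′ := Spec Ω → Spec R → Spec D′`, such that: **`U_{a′} ≫ (e_C ≪≫ congr_e) = (e_A ≪≫ congr_e) ≫ u`**
(★ `fibreBaseChangeIso`, ★ `fibreCongrPtIso`; both natural in the abelian scheme and section-compatible, so `ι(a)`, `λ`, levels ride along);
`U` is the ONLY `D′`-morphism with that `a′`-fibre (★ `pullback_map_injective_of_flat`); and if `u` is an ISOGENY then the fibre of `U` at
EVERY field-valued point of `Spec D′` is an isogeny (in particular at the geometric closed point of ★ (ν4) `exists_iso_fibre_special_along_stagePoint`).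
Engines: ★ (ν2a) `AbelianScheme.exists_field_stage_hom_baseChange_eq_of_algHom`, ★ Néron `existsUnique_hom_map_genericFibre_eq′`, §2, ★ (ν2b)
`isMonHom_of_isMonHom_pullback_map` (along `a′`, dominant by §3 + Mathlib `IsSchemeTheoreticallyDominant.of_isDominant`), ★
`isIsogeny_of_surjective_of_dim_eq` + `exists_isOfRelDim` + `dim_eq_of_isIsogeny`, ★ `isIsogeny_fibreHom_of_isIsogeny_genericFibre`.
[cite: EGAIV3, Thm. 8.8.2 (i)] [cite: BoschLutkebohmertRaynaud1990, §1.2 Prop. 8 and §7.3 Prop. 6 (p. 180)]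
[cite: Artin1986NeronModels, §1 (1.1) (p. 214) and Cor. (1.4) (p. 215)] [cite: GortzWedhorn2023, Prop. 27.176 and Cor. 27.177] -/
theorem exists_finiteStage_hom_extension (R : ValuationSubring Ω) (h : D →+* R) (hh : ∀ d, ((h d : R) : Ω) = algebraMap L Ω (algebraMap D L d))
    (a : Spec (.of Ω) ⟶ Spec (.of D)) (ha : Spec.map (CommRingCat.ofHom (algebraMap L Ω)) ≫ specGenericPoint D L = a)
    (A C : AbelianSchemeOver (Spec (.of D)))
    (u : (A.fibre a).toAbelianVariety ⟶ (C.fibre a).toAbelianVariety) :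
    ∃ (L' : Type u) (_ : Field L') (_ : Algebra L L') (_ : Algebra D L') (_ : IsScalarTower D L L') (_ : Module.Finite L L')
      (χ : L' →ₐ[L] Ω) (h' : integralClosure D L' →+* R)
      (U : (A.baseChange (Spec.map (CommRingCat.ofHom (algebraMap D (integralClosure D L'))))).X ⟶
        (C.baseChange (Spec.map (CommRingCat.ofHom (algebraMap D (integralClosure D L'))))).X)
      (_ : IsMonHom U)
      (e : (specGenericPoint R Ω ≫ Spec.map (CommRingCat.ofHom h')) ≫
        Spec.map (CommRingCat.ofHom (algebraMap D (integralClosure D L'))) = a),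
      Function.Injective χ ∧
      (∀ x, ((h' x : R) : Ω) = χ (x : L')) ∧ h'.comp (algebraMap D (integralClosure D L')) = h ∧
      IsDedekindDomain (integralClosure D L') ∧ IsFractionRing (integralClosure D L') L' ∧
      fibreHom U (specGenericPoint R Ω ≫ Spec.map (CommRingCat.ofHom h')) ≫
          (C.fibreBaseChangeIso _ (specGenericPoint R Ω ≫ Spec.map (CommRingCat.ofHom h')) ≪≫ C.fibreCongrPtIso e).hom =
        (A.fibreBaseChangeIso _ (specGenericPoint R Ω ≫ Spec.map (CommRingCat.ofHom h')) ≪≫ A.fibreCongrPtIso e).hom ≫ u ∧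
      (∀ U' : (A.baseChange (Spec.map (CommRingCat.ofHom (algebraMap D (integralClosure D L'))))).X ⟶
          (C.baseChange (Spec.map (CommRingCat.ofHom (algebraMap D (integralClosure D L'))))).X,
        (Over.pullback (specGenericPoint R Ω ≫ Spec.map (CommRingCat.ofHom h'))).map U' =
          (Over.pullback (specGenericPoint R Ω ≫ Spec.map (CommRingCat.ofHom h'))).map U → U' = U) ∧
      (AbelianVariety.IsIsogeny u →
        ∀ {k : Type u} [Field k] (t : Spec (.of k) ⟶ Spec (.of (integralClosure D L'))), AbelianVariety.IsIsogeny (fibreHom U t)) := by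
  haveI := A.isProper
  haveI := C.isProper
  -- S1: the `Ω`-morphism in the spread engine's currency
  let X : SchemeOver L := (genericFibre D L).obj A.X
  let AC : AbelianScheme L := C.fibre (specGenericPoint D L)
  haveI : QuasiCompact X.hom := by change QuasiCompact (pullback.snd A.X.hom _); infer_instance
  haveI : QuasiSeparated X.hom := by change QuasiSeparated (pullback.snd A.X.hom _); infer_instance
  let eA := pullbackFacObjIso (specGenericPoint D L) (Spec.map (CommRingCat.ofHom (algebraMap L Ω))) a ha A.X
  let eC := pullbackFacObjIso (specGenericPoint D L) (Spec.map (CommRingCat.ofHom (algebraMap L Ω))) a ha C.X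
  let f : (Over.pullback (AbelianScheme.specMap (algebraMap L Ω))).obj X ⟶ (AC.fibre (Algebra.ofId L Ω).toRingHom).X :=
    eA.hom ≫ u.hom.hom.hom ≫ eC.inv
  -- S2: spread to a finite field stage
  have H := AbelianScheme.exists_field_stage_hom_baseChange_eq_of_algHom (k := L) (K := Ω) (Algebra.ofId L Ω) AC X f
  obtain ⟨L', _, _, _, _, φ, hφ, χ, hχinj, hχ, hσ', F, hfield, hfin, hF, -⟩ := H
  -- S3: the stage is a finite field extension `L'` of `L`; `φ = algebraMap L L'`
  letI : Field L' := hfield.toField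
  have hφ' : φ = algebraMap L L' := by rw [← hφ]; rfl
  subst hφ'
  letI : Algebra D L' := ((algebraMap L L').comp (algebraMap D L)).toAlgebra
  haveI : IsScalarTower D L L' := IsScalarTower.of_algebraMap_eq (fun _ => rfl)
  haveI : Module.Finite L L' := hfin
  haveI : FiniteDimensional L L' := hfin
  haveI : Algebra.IsSeparable L L' := inferInstance
  haveI : IsDedekindDomain (integralClosure D L') := integralClosure.isDedekindDomain D L L'
  haveI : IsFractionRing (integralClosure D L') L' := integralClosure.isFractionRing_of_finite_extension L L'
  -- S4: the refined Dedekind stage `D' = integralClosure D L'` inside `R`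
  have Hh' := exists_ringHom_integralClosure_valuationSubring R h hh χ
  obtain ⟨h', hh', hh'h⟩ := Hh'
  -- S5: transport `F` to the generic fibres over the stage `D'`
  have hb₁ : specGenericPoint (integralClosure D L') L' ≫
      Spec.map (CommRingCat.ofHom (algebraMap D (integralClosure D L'))) =
      Spec.map (CommRingCat.ofHom (algebraMap D L')) := by
    change Spec.map _ ≫ Spec.map _ = _
    rw [← Spec.map_comp, ← CommRingCat.ofHom_comp, ← IsScalarTower.algebraMap_eq D (integralClosure D L') L']
  have hb₂ : Spec.map (CommRingCat.ofHom (algebraMap L L')) ≫ specGenericPoint D L =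
      Spec.map (CommRingCat.ofHom (algebraMap D L')) := by
    change Spec.map _ ≫ Spec.map _ = _
    rw [← Spec.map_comp, ← CommRingCat.ofHom_comp, ← IsScalarTower.algebraMap_eq D L L']
  let gA := pullbackFacObjIso (Spec.map (CommRingCat.ofHom (algebraMap D (integralClosure D L'))))
    (specGenericPoint (integralClosure D L') L') _ hb₁ A.X
  let gC := pullbackFacObjIso (Spec.map (CommRingCat.ofHom (algebraMap D (integralClosure D L'))))
    (specGenericPoint (integralClosure D L') L') _ hb₁ C.X
  let kA := pullbackFacObjIso (specGenericPoint D L) (Spec.map (CommRingCat.ofHom (algebraMap L L'))) _ hb₂ A.X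
  let kC := pullbackFacObjIso (specGenericPoint D L) (Spec.map (CommRingCat.ofHom (algebraMap L L'))) _ hb₂ C.X
  let A' := A.baseChange (Spec.map (CommRingCat.ofHom (algebraMap D (integralClosure D L'))))
  let C' := C.baseChange (Spec.map (CommRingCat.ofHom (algebraMap D (integralClosure D L'))))
  let uL : (genericFibre (integralClosure D L') L').obj A'.X ⟶ (genericFibre (integralClosure D L') L').obj C'.X :=
    gA.hom ≫ kA.inv ≫ F ≫ kC.hom ≫ gC.inv
  -- S6: Néron over the Dedekind stage
  have HU := A'.existsUnique_hom_map_genericFibre_eq' L' C' uL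
  obtain ⟨U, hU, -⟩ := HU
  -- S7: the geometric generic point of the stage
  have hχ' : Spec.map (CommRingCat.ofHom χ.toRingHom) ≫ specGenericPoint (integralClosure D L') L' =
      specGenericPoint R Ω ≫ Spec.map (CommRingCat.ofHom h') := by
    change Spec.map _ ≫ Spec.map _ = Spec.map _ ≫ Spec.map _
    rw [← Spec.map_comp, ← Spec.map_comp, ← CommRingCat.ofHom_comp, ← CommRingCat.ofHom_comp]
    congr 2
    ext x
    exact (hh' x).symm
  have he : (specGenericPoint R Ω ≫ Spec.map (CommRingCat.ofHom h')) ≫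
      Spec.map (CommRingCat.ofHom (algebraMap D (integralClosure D L'))) = a := by
    rw [← ha, ← hχ', Category.assoc, hb₁]
    change Spec.map _ ≫ Spec.map _ = Spec.map _ ≫ Spec.map _
    rw [← Spec.map_comp, ← Spec.map_comp, ← CommRingCat.ofHom_comp, ← CommRingCat.ofHom_comp]
    congr 2
    ext x
    change χ (algebraMap D L' x) = algebraMap L Ω (algebraMap D L x)
    rw [IsScalarTower.algebraMap_apply D L L', AlgHom.commutes]
  -- from here on `a` IS the composite `Spec Ω → Spec R → Spec D′ → Spec D`
  subst he
  -- S8: the `Ω`-fibre of `U` is `u` (★ transitivity bookkeeping, §2)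
  have hσ : Spec.map (CommRingCat.ofHom χ.toRingHom) ≫ Spec.map (CommRingCat.ofHom (algebraMap L L')) =
      Spec.map (CommRingCat.ofHom (algebraMap L Ω)) :=
    AbelianScheme.specMap_comp_eq_specMap _ _ _ hσ'
  have IdΩ : (Over.pullback (specGenericPoint R Ω ≫ Spec.map (CommRingCat.ofHom h'))).map U =
      (A.fibreBaseChangeIso (Spec.map (CommRingCat.ofHom (algebraMap D (integralClosure D L'))))
          (specGenericPoint R Ω ≫ Spec.map (CommRingCat.ofHom h'))).hom.hom.hom.hom ≫ u.hom.hom.hom ≫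
        (C.fibreBaseChangeIso (Spec.map (CommRingCat.ofHom (algebraMap D (integralClosure D L'))))
          (specGenericPoint R Ω ≫ Spec.map (CommRingCat.ofHom h'))).inv.hom.hom.hom :=
    pullback_map_eq_of_facChain (Spec.map (CommRingCat.ofHom (algebraMap D (integralClosure D L'))))
      (specGenericPoint D L) (specGenericPoint (integralClosure D L') L') (Spec.map (CommRingCat.ofHom (algebraMap L L')))
      (Spec.map (CommRingCat.ofHom (algebraMap D L'))) hb₁ hb₂ (Spec.map (CommRingCat.ofHom χ.toRingHom))
      (specGenericPoint R Ω ≫ Spec.map (CommRingCat.ofHom h')) hχ' (Spec.map (CommRingCat.ofHom (algebraMap L Ω))) hσ ha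
      A C U F hU u.hom.hom.hom hF
  -- S9: `U` is a homomorphism: its `Ω`-fibre is one, and `Spec Ω → Spec D′` is quasi-compact and schematically dominant
  haveI : IsMonHom ((Over.pullback (specGenericPoint R Ω ≫ Spec.map (CommRingCat.ofHom h'))).map U) := by
    rw [IdΩ]
    haveI := (A.fibreBaseChangeIso (Spec.map (CommRingCat.ofHom (algebraMap D (integralClosure D L'))))
      (specGenericPoint R Ω ≫ Spec.map (CommRingCat.ofHom h'))).hom.hom.hom.isMonHom_hom
    haveI := (C.fibreBaseChangeIso (Spec.map (CommRingCat.ofHom (algebraMap D (integralClosure D L'))))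
      (specGenericPoint R Ω ≫ Spec.map (CommRingCat.ofHom h'))).inv.hom.hom.isMonHom_hom
    haveI := u.hom.hom.isMonHom_hom
    infer_instance
  have h'inj : Function.Injective h' := by
    intro x y hxy
    have h1 : χ (x : L') = χ (y : L') := by rw [← hh', ← hh', hxy]
    exact Subtype.ext (hχinj h1)
  haveI : IsDominant (specGenericPoint R Ω ≫ Spec.map (CommRingCat.ofHom h')) := by
    haveI := isDominant_specMap_of_injective (algebraMap R Ω) Subtype.val_injective
    haveI := isDominant_specMap_of_injective h' h'inj
    infer_instance
  haveI : IsSchemeTheoreticallyDominant (specGenericPoint R Ω ≫ Spec.map (CommRingCat.ofHom h')) :=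
    IsSchemeTheoreticallyDominant.of_isDominant _
  haveI : Flat (A.baseChange (Spec.map (CommRingCat.ofHom (algebraMap D (integralClosure D L'))))).X.hom := by
    haveI := (A.baseChange (Spec.map (CommRingCat.ofHom (algebraMap D (integralClosure D L'))))).isSmooth
    infer_instance
  haveI : IsSeparated (C.baseChange (Spec.map (CommRingCat.ofHom (algebraMap D (integralClosure D L'))))).X.hom := by
    haveI := (C.baseChange (Spec.map (CommRingCat.ofHom (algebraMap D (integralClosure D L'))))).isProper
    infer_instance
  haveI hUmon : IsMonHom U :=
    Literature.AlgebraicGeometry.Limits.isMonHom_of_isMonHom_pullback_map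
      (specGenericPoint R Ω ≫ Spec.map (CommRingCat.ofHom h')) _ _ U
  -- S10: assemble
  have huniq : ∀ U' : (A.baseChange (Spec.map (CommRingCat.ofHom (algebraMap D (integralClosure D L'))))).X ⟶
      (C.baseChange (Spec.map (CommRingCat.ofHom (algebraMap D (integralClosure D L'))))).X,
      (Over.pullback (specGenericPoint R Ω ≫ Spec.map (CommRingCat.ofHom h'))).map U' =
        (Over.pullback (specGenericPoint R Ω ≫ Spec.map (CommRingCat.ofHom h'))).map U → U' = U :=
    fun U' hU' => Literature.AlgebraicGeometry.Limits.pullback_map_injective_of_flat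
      (specGenericPoint R Ω ≫ Spec.map (CommRingCat.ofHom h')) hU'
  refine ⟨L', inferInstance, inferInstance, inferInstance, inferInstance, inferInstance, χ, h', U, hUmon, rfl, hχinj,
    hh', hh'h, inferInstance, inferInstance, ?_, huniq, ?_⟩
  · -- the fibre identification, read through `fibreHom` (the point equality is `rfl`: `fibreCongrPtIso rfl = Iso.refl`)
    have hcA : A.fibreCongrPtIso (rfl : (specGenericPoint R Ω ≫ Spec.map (CommRingCat.ofHom h')) ≫
        Spec.map (CommRingCat.ofHom (algebraMap D (integralClosure D L'))) = _) = Iso.refl _ := rfl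
    have hcC : C.fibreCongrPtIso (rfl : (specGenericPoint R Ω ≫ Spec.map (CommRingCat.ofHom h')) ≫
        Spec.map (CommRingCat.ofHom (algebraMap D (integralClosure D L'))) = _) = Iso.refl _ := rfl
    rw [hcA, hcC, Iso.trans_refl, Iso.trans_refl]
    apply AbelianVariety.hom_ext
    change (Over.pullback (specGenericPoint R Ω ≫ Spec.map (CommRingCat.ofHom h'))).map U ≫
        (C.fibreBaseChangeIso _ _).hom.hom.hom.hom = (A.fibreBaseChangeIso _ _).hom.hom.hom.hom ≫ u.hom.hom.hom
    have hinv : (C.fibreBaseChangeIso (Spec.map (CommRingCat.ofHom (algebraMap D (integralClosure D L'))))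
          (specGenericPoint R Ω ≫ Spec.map (CommRingCat.ofHom h'))).inv.hom.hom.hom ≫
        (C.fibreBaseChangeIso (Spec.map (CommRingCat.ofHom (algebraMap D (integralClosure D L'))))
          (specGenericPoint R Ω ≫ Spec.map (CommRingCat.ofHom h'))).hom.hom.hom.hom = 𝟙 _ := by
      change ((C.fibreBaseChangeIso _ _).inv ≫ (C.fibreBaseChangeIso _ _).hom).hom.hom.hom = _
      rw [Iso.inv_hom_id]
      rfl
    rw [IdΩ]
    simp only [Category.assoc, hinv, Category.comp_id]
  · -- isogenies: the generic fibre of `U` over `L′` is an isogeny (surjective of the right dimension), hence every fibre is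
    intro hu k _ t
    have isoIsog : ∀ {X Y : AbelianVariety Ω} (e : X ≅ Y), AbelianVariety.IsIsogeny e.hom := by
      intro X Y e
      haveI : IsIso (AbelianVariety.Hom.toSchemeHom e.hom) :=
        ⟨AbelianVariety.Hom.toSchemeHom e.inv,
          by
            change AbelianVariety.Hom.toSchemeHom (e.hom ≫ e.inv) = _
            rw [e.hom_inv_id]; rfl,
          by
            change AbelianVariety.Hom.toSchemeHom (e.inv ≫ e.hom) = _
            rw [e.inv_hom_id]; rfl⟩
      exact ⟨inferInstance, inferInstance⟩
    -- (i) surjectivity of the generic fibre `uL` of `U`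
    haveI : Surjective u.hom.hom.hom.left := hu.1
    haveI : Surjective (Spec.map (CommRingCat.ofHom χ.toRingHom)) :=
      Literature.AlgebraicGeometry.Limits.surjective_specMap_of_field χ.toRingHom
    have isoSurj : ∀ {T : Scheme.{u}} {P Q : Over T} (e : P ≅ Q), Surjective e.hom.left ∧ Surjective e.inv.left := by
      intro T P Q e
      haveI : IsIso e.hom.left := ((Over.forget T).mapIso e).isIso_hom
      haveI : IsIso e.inv.left := ((Over.forget T).mapIso e).isIso_inv
      exact ⟨inferInstance, inferInstance⟩
    have sf : Surjective f.left := by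
      change Surjective (eA.hom ≫ u.hom.hom.hom ≫ eC.inv).left
      simp only [Over.comp_left]
      haveI := (isoSurj eA).1
      haveI := (isoSurj eC).2
      infer_instance
    have sF : Surjective F.left := by
      have h1 : ((Over.pullback (Spec.map (CommRingCat.ofHom χ.toRingHom))).map F).left ≫
          pullback.fst _ (Spec.map (CommRingCat.ofHom χ.toRingHom)) =
          pullback.fst _ (Spec.map (CommRingCat.ofHom χ.toRingHom)) ≫ F.left := by
        simp only [Over.pullback_map_left, pullback.lift_fst]
      haveI : Surjective ((Over.pullback (Spec.map (CommRingCat.ofHom χ.toRingHom))).map F).left := by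
        rw [hF, AbelianScheme.fibreFacIso_inv_hom_hom_hom]
        simp only [Over.comp_left]
        haveI := (isoSurj (AbelianScheme.srcFacIso χ.toRingHom (algebraMap L Ω) hσ' X)).1
        haveI := (isoSurj (pullbackFacObjIso (AbelianScheme.specMap (algebraMap L L'))
          (AbelianScheme.specMap χ.toRingHom) (AbelianScheme.specMap (Algebra.ofId L Ω).toRingHom)
          (AbelianScheme.specMap_comp_eq_specMap _ _ _ hχ) AC.X)).2
        haveI := sf
        infer_instance
      haveI : Surjective (pullback.fst ((Over.pullback (AbelianScheme.specMap (algebraMap L L'))).obj X).hom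
          (Spec.map (CommRingCat.ofHom χ.toRingHom)) ≫ F.left) := by
        rw [← h1]; infer_instance
      exact Surjective.of_comp (f := pullback.fst ((Over.pullback (AbelianScheme.specMap (algebraMap L L'))).obj X).hom
        (Spec.map (CommRingCat.ofHom χ.toRingHom))) (g := F.left)
    haveI : Surjective (AbelianVariety.Hom.toSchemeHom (fibreHom U (specGenericPoint (integralClosure D L') L'))) := by
      change Surjective ((genericFibre (integralClosure D L') L').map U).left
      rw [hU]
      change Surjective (gA.hom ≫ kA.inv ≫ F ≫ kC.hom ≫ gC.inv).left
      simp only [Over.comp_left]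
      haveI := (isoSurj gA).1
      haveI := (isoSurj kA).2
      haveI := (isoSurj kC).1
      haveI := (isoSurj gC).2
      haveI := sF
      infer_instance
    -- (ii) the dimensions agree (relative dimension is constant over the connected `Spec D′`; `u` is an isogeny)
    haveI : ConnectedSpace ↥(Spec (CommRingCat.of (integralClosure D L'))) := inferInstance
    obtain ⟨gA', hA'⟩ := A'.exists_isOfRelDim
    obtain ⟨gC', hC'⟩ := C'.exists_isOfRelDim
    have hdim : ((A'.fibre (specGenericPoint (integralClosure D L') L')).toAbelianVariety).dim =
        ((C'.fibre (specGenericPoint (integralClosure D L') L')).toAbelianVariety).dim := by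
      rw [dim_fibre_of_isOfRelDim hA', dim_fibre_of_isOfRelDim hC',
        ← dim_fibre_of_isOfRelDim hA' (specGenericPoint R Ω ≫ Spec.map (CommRingCat.ofHom h')),
        ← dim_fibre_of_isOfRelDim hC' (specGenericPoint R Ω ≫ Spec.map (CommRingCat.ofHom h')),
        AbelianVariety.dim_eq_of_isIsogeny (isoIsog (A.fibreBaseChangeIso
          (Spec.map (CommRingCat.ofHom (algebraMap D (integralClosure D L')))) (specGenericPoint R Ω ≫ Spec.map (CommRingCat.ofHom h')))),
        AbelianVariety.dim_eq_of_isIsogeny (isoIsog (C.fibreBaseChangeIso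
          (Spec.map (CommRingCat.ofHom (algebraMap D (integralClosure D L')))) (specGenericPoint R Ω ≫ Spec.map (CommRingCat.ofHom h')))),
        AbelianVariety.dim_eq_of_isIsogeny hu]
    have hiso : AbelianVariety.IsIsogeny (fibreHom U (specGenericPoint (integralClosure D L') L')) :=
      AbelianVariety.isIsogeny_of_surjective_of_dim_eq _ hdim
    exact isIsogeny_fibreHom_of_isIsogeny_genericFibre L' U hiso t

end AbelianSchemeOver
end Literature.AlgebraicGeometry.AbelianSchemes

end
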